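import Literature.Barriers.CriticalPhenomena.GridSAWCountingFixedLengthOfGadgets
import Literature.Barriers.CriticalPhenomena.GridSAWCountingGridHamPathHardnessProofs
import HarnessLib

/-!
# Theorem 7 (1) of LOT2003: `#SAW(E, s, t)` on grid graphs is `#P`-complete — discharge

Sibling proof file of `GridSAWCountingSharpPComplete.lean` (Liśkiewicz–Ogihara–Toda 2003,
Theorem 7 (1)): the named statement

  `LOT2003_thm7_fixedLength : IsSharpPCompleteRShift SAWCOUNT₁`

("counting the self-avoiding walks of length `t − s`... between two given vertices of a subgraph of
the two-dimensional grid is `#P`-complete under polynomial-time right-bit-shift reductions") is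
PROVED here, `LOT2003_thm7_fixedLength_holds`.

The printed proof (§4) chains: membership in `#P`; Proposition 2 (`#SAT ≤ #3SAT`, parsimonious
Cook–Levin); Lemma 3 (the normal form, `#3SAT ≤ #3SAT_NF` halving the count); Lemma 4 with the
grid embedding `E₀` (`#3SAT_NF(ψ) · 2 = #HamPath(G_ψ)` for a polynomial-time computable named grid
drawing of `G_ψ`); and the towers `E₀ ↦ E₄` reading the Hamiltonian-path count off the top bits
of the fixed-length SAW count. The first, second, third and fifth steps were discharged earlier
(`LOT2003_thm7_fixedLength_of_gadgets`, `GridSAWCountingFixedLengthOfGadgets.lean`); the fourth is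
`LOT2003_lemma4_gadgets_holds` (`GridSAWCountingGridHamPathHardnessProofs.lean`: a grid drawing of
the gadget graph of a formula in normal form, valid, drawing the graph, with the Hamiltonian-path
count `2 · #SAT`, and polynomial-time computable drawing data — the hypotheses of
`LOT2003_lemma4_gadgets_of_family`, `GridSAWGadgetsFromDrawnFamily.lean`; an independent drawing of
the grid-native gadget graph `graphOf ψ` of `GridFormulaCount.lean` with the same four properties is
`GridSAWFormulaDrawing.lean`/`GridSAWFormulaDrawingGraph.lean`/`GridSAWFormulaDrawingFP.lean`).

## References

* M. Liśkiewicz, M. Ogihara, S. Toda, *The complexity of counting self-avoiding walks in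
  subgraphs of two-dimensional grids and hypercubes*, TCS 304 (2003) 129–156, Theorem 7 (1) and
  its proof (§4); Proposition 2, Lemma 3, Lemma 4 (§3).
-/

namespace Literature.Barriers.CriticalPhenomena.GridSAW

/-- **Theorem 7 (1) of [LOT2003]**: `#SAW(E, s, t)` — the number of self-avoiding walks of the
fixed length between two given vertices of a subgraph of the two-dimensional grid — is
`#P`-complete under polynomial-time right-bit-shift reductions.
[cite: LiskiewiczOgiharaToda2003, Theorem 7 (1), proof in §4] -/
theorem LOT2003_thm7_fixedLength_holds : LOT2003_thm7_fixedLength :=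
  LOT2003_thm7_fixedLength_of_gadgets LOT2003_lemma4_gadgets_holds

end Literature.Barriers.CriticalPhenomena.GridSAW
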